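import Literature.Barriers.ValiantsHypothesis.CT23ExplicitAnnihilatorEncoder
import HarnessLib

/-!
# The explicit encoder of the annihilator matrix — pre-specialised rows and the CIRCUIT
# (Chatterjee–Tengse arXiv:2309.07612v2, Lemma 3.5 = v1 Lemma 42; val-lit p2 g8, X-CT23 engine
# brick E-e′, file 3: "there is a purely algebraic circuit `M̃_G` that encodes `M̃` … uses only a
# single `C_G` gate and has overall size `O((nd)³ + n · size(C_G))`")

Theorem-only (plus plumbing `def`s) companion of `CT23ExplicitAnnihilatorEncoder.lean` (this
seat: the encoder POLYNOMIAL `annEnc` in the Def-1.7 reading and `matOf_annEnc`) and of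
`CT23AnnihilatorPrefixColumns.lean` (prefix data `prefixLen`/`prefixAnnMatrix`); NO named facts.
Honest framing: circuit bookkeeping for a printed `VPSPACE` construction (consequences-side
literature); it discharges nothing by itself; `VP ≠ VNP` is NOT proved and nothing here bears on
it.

## Contents

* §1 **Pre-specialised rows** (interface agreed with the assembly seat t18 g8, bus 11:28Z/11:58Z):
  the encoder skeleton `encoderSkeleton x a b Kb g` = `annEnc` with the row values `g_t(pow(i))`
  abstracted into a family `g : Fin n → F[τ]` (`annEnc_eq_encoderSkeleton`: the Def-1.7 form is
  the instance `g t = U(pow, c_t)`); the canonical instance `gKron a α Δ (G t) = (G t)(pow(i))`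
  (the source's "`n` copies `C_G(·, a_t)`" pre-specialised); **`matOf_encoderSkeleton`** /
  **`det_matOf_encoderSkeleton`** for ANY family that evaluates to `(G t)(v_{α,i})` under the bit
  substitution, and the `prefixAnnMatrix` form `det_matOf_encoderSkeleton_prefix` (for every `α`).
* §2 **Circuit-size bookkeeping** in the tree's fan-in-two `complexity` (Bürgisser's `L`): the
  gadgets `EQ/LT/GT` on inputs of complexity `≤ c₀` (`O(ℓ²)` as printed in Obs. 2.9), `pow(i)`
  (`kronPow`, `≤ 5L + 1` with the powers `α^{2^ℓ Δ^k}` as CONSTANT gates — the source computes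
  them constant-freely from `α`; for Thm. 3.1, whose conclusion has no constant-freeness clause,
  constants suffice; the constant-free twin needed by Lemma 4.7 is NOT in this file), and the
  skeleton with PLACEHOLDER variables `p_t` for the row values (`complexity_encoderSkeleton_le`).
* §3 **The circuit** (`encCircuit`): prefix = fan-in-two circuits for `pow(i)_k` (juxtaposed,
  `ArithCircuit.juxtGates`), then the `n` INPUT-FREE row circuits `Q_t` (projection circuits
  computing `G t` read on `Fin m ⊕ Fin w`, projecting only their workspace `Fin w` — the
  normalised encoders of the assembly) with `z ↦ pow(i)` substituted by t18's `ProjCircuit.subst`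
  (brick E-a; sound by `SubstCompat` since the `Q_t` project only workspace variables), then a
  fan-in-two circuit for the skeleton with the placeholders `p_t` substituted by the outputs of the
  `Q_t`. Results: **`eval_encCircuit`** (computes `encoderSkeleton x a b Kb (gKron ∘ G)`),
  **`size_encCircuit_le`** (`≤ n·s + poly(n, m, δ, 2^δ)`), `isFanInTwo_encCircuit`,
  `projVars_encCircuit_subset` (projects only the images `ws` of the workspace variables), and
  the packaged existence statement `exists_encoderCircuit`.

## References

* [ChatterjeeTengse2023] P. Chatterjee, A. Tengse, *Lower Bounds from Succinct Hitting Sets*,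
  arXiv:2309.07612v2, Lemma 3.5 and its proof, Obs. 2.9 (v1: Lemma 42, p0015.txt:L57–L102,
  p0016.txt:L1–L8; Obs. 17).
* [Burgisser2000] P. Bürgisser, *Completeness and Reduction in Algebraic Complexity Theory*,
  Springer 2000, Def. 2.1, Rem. 2.7 (straight-line programs; substitution) — the tree's
  `ArithCircuit` / `complexity` / `juxtGates` / `substCircuit`.
-/

noncomputable section

open MvPolynomial Matrix

namespace Literature.Barriers.ValiantsHypothesis

namespace CT23Encoder

open Literature.Computability.AlgebraicComplexity BitGadget

universe u v

variable {F : Type u} [Field F] {τ : Type v} [DecidableEq τ]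

/-! ### §1 Pre-specialised rows: the encoder skeleton over a family of row values -/

section Skeleton

variable {n m r δ : ℕ} {x : Fin n → τ} {a b : Fin (n * δ) → τ}

/-- `ROW(i)_t` over an abstract row value `g_t`: `LT(i,k) · g_t + EQ(i,k) · x_t`.
[cite: ChatterjeeTengse2023, Lemma 3.5, `ROW` (v1: Lemma 42; p0015.txt:L97)] -/
def rowPolyG (x : Fin n → τ) (a : Fin (n * δ) → τ) (Kb : Fin (n * δ) → Bool)
    (g : Fin n → MvPolynomial τ F) (t : Fin n) : MvPolynomial τ F :=
  BitGadget.LT (n * δ) (varVec a) (constVec Kb) * g t + EQ (n * δ) (varVec a) (constVec Kb) * X (x t)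

/-- **The encoder skeleton**: `act(a)·act(b)·∏_t colPow_t(ROW_t) + (1 − act(b))·EQ(a,b)` over
an abstract family of row values. [cite: ChatterjeeTengse2023, Lemma 3.5 (v1: Lemma 42; p0015.txt:L96–L99)] -/
def encoderSkeleton (x : Fin n → τ) (a b : Fin (n * δ) → τ) (Kb : Fin (n * δ) → Bool)
    (g : Fin n → MvPolynomial τ F) : MvPolynomial τ F :=
  actPoly a Kb * actPoly b Kb * (∏ t : Fin n, colPow b (rowPolyG x a Kb g t) t) +
    (1 - actPoly b Kb) * EQ (n * δ) (varVec a) (varVec b)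

omit [DecidableEq τ] in
/-- The Def-1.7 encoder `annEnc` is the skeleton at the rows `U(pow(i), c_t)`.
[cite: ChatterjeeTengse2023, Lemma 3.5 (v1: Lemma 42; p0015.txt:L96–L99)] -/
theorem annEnc_eq_encoderSkeleton (Kb : Fin (n * δ) → Bool) (α : F) (Δ : ℕ)
    (U : MvPolynomial (Fin m ⊕ Fin r) F) (c : Fin n → Fin r → F) :
    annEnc x a b Kb α Δ U c = encoderSkeleton x a b Kb (fun t => gAt a α Δ U (c t)) := rfl

/-- **The pre-specialised row value** `g(pow(i))`: a polynomial `g ∈ F[z_1..z_m]` with the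
Kronecker coordinates substituted (the source's `C_G(pow(i))` for ONE output, specialised).
[cite: ChatterjeeTengse2023, Lemma 3.5, `C_G(pow(i))` (v1: Lemma 42; p0015.txt:L97)] -/
def gKron (a : Fin (n * δ) → τ) (α : F) (Δ : ℕ) (g : MvPolynomial (Fin m) F) : MvPolynomial τ F :=
  aeval (fun k => kronPow a α Δ k) g

omit [DecidableEq τ] in
/-- Substituting constants is evaluation followed by `C`. [folklore] -/
private theorem aeval_C_comp' {σ : Type*} (v : σ → F) (p : MvPolynomial σ F) :
    aeval (fun i => (C (v i) : MvPolynomial τ F)) p = C (eval v p) := by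
  induction p using MvPolynomial.induction_on with
  | C c => simp
  | add p q hp hq => rw [map_add, map_add, hp, hq, map_add]
  | mul_X p i hp => rw [map_mul, hp, aeval_X, map_mul, eval_X, map_mul]

/-- **`g(pow(i))` is the evaluation of `g` at the Kronecker point of the row**, as a constant.
[cite: ChatterjeeTengse2023, Lemma 3.5 (v1: Lemma 42; p0016.txt:L1–L3)] -/
theorem aeval_bitSubst_gKron (lay : EncLayout x a b) (βa βb : Fin (n * δ) → Bool) (α : F) (Δ : ℕ)
    (g : MvPolynomial (Fin m) F) :
    aeval (bitSubst (F := F) a b βa βb) (gKron a α Δ g) =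
      C (eval (kronPoint Δ (α ^ (bitsVal _ βa + 1))) g) := by
  rw [gKron, ← AlgHom.comp_apply, comp_aeval]
  have hs : (fun k : Fin m => aeval (bitSubst (F := F) a b βa βb) (kronPow a α Δ k)) =
      fun k => C (kronPoint Δ (α ^ (bitsVal _ βa + 1)) k) :=
    funext fun k => aeval_bitSubst_kronPow lay βa βb α Δ k
  rw [hs, aeval_C_comp']

/-- **`ROW` over a family under the bit substitution**: `[val i < K] · (G t)(v_{α,i}) + [val i = K] · x_t`
when `g_t` evaluates to `(G t)(v_{α,i})`. [cite: ChatterjeeTengse2023, Lemma 3.5 (v1: Lemma 42; p0016.txt:L2–L3)] -/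
theorem aeval_bitSubst_rowPolyG (lay : EncLayout x a b) (βa βb : Fin (n * δ) → Bool) {K : ℕ}
    (hK : K < 2 ^ (n * δ)) (α : F) (Δ : ℕ) {g : Fin n → MvPolynomial τ F}
    {G : Fin n → MvPolynomial (Fin m) F}
    (hg : ∀ t, aeval (bitSubst (F := F) a b βa βb) (g t) =
      C (eval (kronPoint Δ (α ^ (bitsVal _ βa + 1))) (G t))) (t : Fin n) :
    aeval (bitSubst (F := F) a b βa βb) (rowPolyG x a (natBits _ K hK) g t) =
      bitVal (decide (bitsVal _ βa < K)) *
          C (eval (kronPoint Δ (α ^ (bitsVal _ βa + 1))) (G t)) +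
        bitVal (decide (bitsVal _ βa = K)) * X (x t) := by
  rw [rowPolyG, map_add, map_mul, map_mul, aeval_bitSubst_LT_const lay, hg t,
    aeval_bitSubst_EQ_const lay, aeval_X, bitSubst_x lay]

/-- The core entry of the skeleton on an EVALUATION row. [cite: ChatterjeeTengse2023, Lemma 3.5 / Lemma 3.2 (v1: Lemma 42, p0015.txt:L62–L64)] -/
theorem aeval_bitSubst_coreG_lt (lay : EncLayout x a b) (βa βb : Fin (n * δ) → Bool) {K : ℕ}
    (hK : K < 2 ^ (n * δ)) (α : F) (Δ : ℕ) {g : Fin n → MvPolynomial τ F}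
    {G : Fin n → MvPolynomial (Fin m) F}
    (hg : ∀ t, aeval (bitSubst (F := F) a b βa βb) (g t) =
      C (eval (kronPoint Δ (α ^ (bitsVal _ βa + 1))) (G t))) (hlt : bitsVal _ βa < K) :
    aeval (bitSubst (F := F) a b βa βb) (∏ t : Fin n, colPow b (rowPolyG x a (natBits _ K hK) g t) t) =
      C (eval (kronPoint Δ (α ^ (bitsVal _ βa + 1))) (∏ t, G t ^ blockExp n δ βb t)) := by
  rw [map_prod, map_prod, map_prod]
  refine Finset.prod_congr rfl fun t _ => ?_
  rw [aeval_bitSubst_colPow lay, aeval_bitSubst_rowPolyG lay βa βb hK α Δ hg, map_pow, map_pow]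
  have hne : bitsVal _ βa ≠ K := hlt.ne
  simp [hlt, hne]

/-- The core entry of the skeleton on the SYMBOLIC row. [cite: ChatterjeeTengse2023, Lemma 3.5 / Lemma 3.2 (v1: Lemma 42, p0015.txt:L62–L64)] -/
theorem aeval_bitSubst_coreG_eq (lay : EncLayout x a b) (βa βb : Fin (n * δ) → Bool) {K : ℕ}
    (hK : K < 2 ^ (n * δ)) (α : F) (Δ : ℕ) {g : Fin n → MvPolynomial τ F}
    {G : Fin n → MvPolynomial (Fin m) F}
    (hg : ∀ t, aeval (bitSubst (F := F) a b βa βb) (g t) =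
      C (eval (kronPoint Δ (α ^ (bitsVal _ βa + 1))) (G t))) (heq : bitsVal _ βa = K) :
    aeval (bitSubst (F := F) a b βa βb) (∏ t : Fin n, colPow b (rowPolyG x a (natBits _ K hK) g t) t) =
      rename x (monomial (blockExp n δ βb) 1) := by
  rw [map_prod]
  have hmon : rename x (monomial (blockExp n δ βb) (1 : F)) = ∏ t, X (x t) ^ blockExp n δ βb t := by
    rw [monomial_eq, map_one, one_mul, Finsupp.prod_pow, map_prod]
    simp
  rw [hmon]
  refine Finset.prod_congr rfl fun t _ => ?_
  rw [aeval_bitSubst_colPow lay, aeval_bitSubst_rowPolyG lay βa βb hK α Δ hg]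
  simp [heq]

/-- **The skeleton encodes the padded `M̃`** for ANY family of row values that evaluates to
`(G t)(v_{α,i})` under the bit substitution (generalising `matOf_annEnc`).
[cite: ChatterjeeTengse2023, Lemma 3.5 (v1: Lemma 42; p0015.txt:L74–L102, p0016.txt:L1–L8)] -/
theorem matOf_encoderSkeleton (lay : EncLayout x a b) {K : ℕ} (hK : K + 1 ≤ 2 ^ (n * δ)) (α : F)
    (Δ : ℕ) {g : Fin n → MvPolynomial τ F} {G : Fin n → MvPolynomial (Fin m) F}
    (hg : ∀ t βa βb, aeval (bitSubst (F := F) a b βa βb) (g t) =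
      C (eval (kronPoint Δ (α ^ (bitsVal _ βa + 1))) (G t))) :
    matOf a b (encoderSkeleton x a b (natBits _ K (Nat.lt_of_succ_le hK)) g) =
      padMatrix K ((rename x).toRingHom.mapMatrix
        (annMatrix (Matrix.of fun (i : Fin K) (j : Fin (K + 1)) =>
            eval (kronPoint Δ (α ^ ((i : ℕ) + 1))) (∏ t, G t ^ blockEnum n δ (Fin.castLE hK j) t))
          (blockEnum n δ ∘ Fin.castLE hK))) := by
  have hKlt : K < 2 ^ (n * δ) := Nat.lt_of_succ_le hK
  refine Matrix.ext fun βa βb => ?_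
  rw [matOf_apply', padMatrix, Matrix.of_apply]
  simp only [encoderSkeleton, actPoly, map_add, map_mul, map_sub, map_one,
    aeval_bitSubst_GT_const_a lay, aeval_bitSubst_GT_const_b lay, aeval_bitSubst_EQ_ab lay]
  by_cases hb : bitsVal _ βb ≤ K
  · have hbK : ¬ K < bitsVal _ βb := not_lt.2 hb
    rw [dif_pos hb]
    simp only [hbK, decide_false, bitVal_false, sub_zero, mul_one, sub_self, zero_mul, add_zero]
    have hcol : blockEnum n δ (Fin.castLE hK ⟨bitsVal _ βb, Nat.lt_succ_of_le hb⟩) = blockExp n δ βb :=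
      blockEnum_val βb _
    by_cases ha : bitsVal _ βa ≤ K
    · have haK : ¬ K < bitsVal _ βa := not_lt.2 ha
      rw [dif_pos ha]
      simp only [haK, decide_false, bitVal_false, sub_zero, one_mul, RingHom.mapMatrix_apply,
        Matrix.map_apply]
      rcases ha.lt_or_eq with hlt | heq
      · rw [aeval_bitSubst_coreG_lt lay βa βb hKlt α Δ (fun t => hg t βa βb) hlt]
        have hrow : (⟨bitsVal _ βa, Nat.lt_succ_of_le ha⟩ : Fin (K + 1)) =
            Fin.castSucc ⟨bitsVal _ βa, hlt⟩ := Fin.ext rfl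
        rw [hrow, annMatrix_castSucc, Matrix.of_apply, hcol]
        simp
      · rw [aeval_bitSubst_coreG_eq lay βa βb hKlt α Δ (fun t => hg t βa βb) heq]
        have hrow : (⟨bitsVal _ βa, Nat.lt_succ_of_le ha⟩ : Fin (K + 1)) = Fin.last K := Fin.ext heq
        rw [hrow, annMatrix_last, Function.comp_apply, hcol]
        rfl
    · have haK : K < bitsVal _ βa := not_le.1 ha
      rw [dif_neg ha]
      simp [haK]
  · have hbK : K < bitsVal _ βb := not_le.1 hb
    rw [dif_neg hb]
    simp only [hbK, decide_true, bitVal_true, sub_self, mul_zero, zero_mul, zero_add, sub_zero, one_mul]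
    by_cases hab : βa = βb
    · subst hab; simp [bitVal]
    · simp [hab, bitVal]

/-- **`det` of the encoded matrix is `det M̃` read along `x`** (any such family of rows).
[cite: ChatterjeeTengse2023, Lemma 3.5 (v1: Lemma 42; p0015.txt:L74–L79)] -/
theorem det_matOf_encoderSkeleton (lay : EncLayout x a b) {K : ℕ} (hK : K + 1 ≤ 2 ^ (n * δ))
    (α : F) (Δ : ℕ) {g : Fin n → MvPolynomial τ F} {G : Fin n → MvPolynomial (Fin m) F}
    (hg : ∀ t βa βb, aeval (bitSubst (F := F) a b βa βb) (g t) =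
      C (eval (kronPoint Δ (α ^ (bitsVal _ βa + 1))) (G t))) :
    (matOf a b (encoderSkeleton x a b (natBits _ K (Nat.lt_of_succ_le hK)) g)).det =
      rename x (annMatrix (Matrix.of fun (i : Fin K) (j : Fin (K + 1)) =>
            eval (kronPoint Δ (α ^ ((i : ℕ) + 1))) (∏ t, G t ^ blockEnum n δ (Fin.castLE hK j) t))
          (blockEnum n δ ∘ Fin.castLE hK)).det := by
  rw [matOf_encoderSkeleton lay hK α Δ hg, det_padMatrix hK, ← RingHom.map_det]
  rfl

/-- **Prefix form, every `α`**: with `K = prefixLen` of the bit-block enumeration and the rows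
`gKron ∘ G`, the encoded determinant is `det (prefixAnnMatrix G (blockEnum n δ) hdep Δ α)` read
along `x` (the `α`-uniform matrix of the prefix-columns file; its annihilation / degree /
non-vanishing clauses are `aeval_det_prefixAnnMatrix`, `degreeOf_det_prefixAnnMatrix_lt`,
`det_prefixAnnMatrix_ne_zero`). [cite: ChatterjeeTengse2023, Lemma 3.5 with Lemma 3.2 (v1: Lemma 42, Lemma 39)] -/
theorem det_matOf_encoderSkeleton_prefix (lay : EncLayout x a b)
    (G : Fin n → MvPolynomial (Fin m) F)
    (hdep : ¬ LinearIndependent F (fun j => ∏ t, G t ^ blockEnum n δ j t)) (α : F) (Δ : ℕ) :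
    (matOf a b (encoderSkeleton x a b
        (natBits _ (prefixLen G (blockEnum n δ) hdep)
          (Nat.lt_of_succ_le (prefixLen_succ_le G (blockEnum n δ) hdep)))
        (fun t => gKron a α Δ (G t)))).det =
      rename x (prefixAnnMatrix G (blockEnum n δ) hdep Δ α).det :=
  det_matOf_encoderSkeleton lay (prefixLen_succ_le G (blockEnum n δ) hdep) α Δ
    (fun t βa βb => aeval_bitSubst_gKron lay βa βb α Δ (G t))

end Skeleton


/-! ### §2 Circuit-size bookkeeping in Bürgisser's `L` (fan-in two, constants allowed) -/

section Complexity

variable {σ : Type*}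

omit [DecidableEq τ] in
/-- `L(1 − p) ≤ L(p) + 2`. [cite: Burgisser2000, Def. 2.1] -/
private theorem cx_one_sub (p : MvPolynomial σ F) : complexity (1 - p) ≤ complexity p + 2 := by
  have h : (1 - p : MvPolynomial σ F) = C 1 + (-1 : F) • p := by
    rw [neg_one_smul, C_1, sub_eq_add_neg]
  rw [h]
  have h1 := complexity_add_le_holds (C (1 : F) : MvPolynomial σ F) ((-1 : F) • p)
  have h2 := complexity_smul_le_holds (σ := σ) (-1 : F) p
  have h3 : complexity (C (1 : F) : MvPolynomial σ F) = 0 := complexity_C_holds (1 : F)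
  omega

omit [DecidableEq τ] in
/-- `L(f^e) ≤ L(f) + e` (compute `f` once, then multiply). [cite: Burgisser2000, §2.1] -/
private theorem cx_pow (f : MvPolynomial σ F) (e : ℕ) : complexity (f ^ e) ≤ complexity f + e := by
  classical
  have h := complexity_aeval_le (X () ^ e : MvPolynomial Unit F) (fun _ => f)
  rw [map_pow, aeval_X] at h
  refine h.trans ?_
  rw [Fintype.sum_unique, add_comm]
  refine Nat.add_le_add_left ?_ _
  have h2 := complexity_finset_prod_le (Finset.range e) (fun _ => (X () : MvPolynomial Unit F))
  rw [Finset.prod_const, Finset.card_range] at h2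
  refine h2.trans ?_
  rw [Finset.sum_eq_zero fun j _ => complexity_X_holds (k := F) (), zero_add]

omit [DecidableEq τ] in
/-- `L(0) = L(1) = 0` for the gadget constants. [cite: Burgisser2000, Def. 2.1] -/
private theorem cx_bitVal (c : Bool) : complexity (bitVal c : MvPolynomial σ F) = 0 := by
  cases c
  · simpa [bitVal] using complexity_C_holds (σ := σ) (0 : F)
  · simpa [bitVal] using complexity_C_holds (σ := σ) (1 : F)

omit [DecidableEq τ] in
/-- **`L(eqBit(u, v)) ≤ 2(L u + L v) + 7`.** [cite: ChatterjeeTengse2023, Obs. 2.9 (v1: Obs. 17)] -/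
theorem complexity_eqBit_le (u v : MvPolynomial σ F) :
    complexity (eqBit u v) ≤ 2 * (complexity u + complexity v) + 7 := by
  rw [eqBit]
  have h1 := complexity_mul_le_holds u v
  have h2 := complexity_mul_le_holds (1 - u) (1 - v)
  have h3 := cx_one_sub (F := F) u
  have h4 := cx_one_sub (F := F) v
  have h5 := complexity_add_le_holds (u * v) ((1 - u) * (1 - v))
  omega

omit [DecidableEq τ] in
/-- **`L(EQ_ℓ) ≤ ℓ(4c₀ + 8)`** on inputs of complexity `≤ c₀` (Obs. 2.9's `O(ℓ²)` with the inputs'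
cost made explicit). [cite: ChatterjeeTengse2023, Obs. 2.9 (v1: Obs. 17)] -/
theorem complexity_EQ_le (c₀ : ℕ) : ∀ (ℓ : ℕ) (u v : Fin ℓ → MvPolynomial σ F),
    (∀ i, complexity (u i) ≤ c₀) → (∀ i, complexity (v i) ≤ c₀) →
      complexity (EQ ℓ u v) ≤ ℓ * (4 * c₀ + 8)
  | 0, u, v, _, _ => by simpa [BitGadget.EQ] using (complexity_C_holds (σ := σ) (1 : F)).le
  | ℓ + 1, u, v, hu, hv => by
    rw [BitGadget.EQ]
    have h1 := complexity_eqBit_le (F := F) (u 0) (v 0)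
    have h2 := complexity_EQ_le c₀ ℓ (Fin.tail u) (Fin.tail v) (fun i => hu _) (fun i => hv _)
    have h3 := complexity_mul_le_holds (eqBit (u 0) (v 0)) (EQ ℓ (Fin.tail u) (Fin.tail v))
    have hu0 := hu 0
    have hv0 := hv 0
    nlinarith

omit [DecidableEq τ] in
/-- **`L(LT_ℓ) ≤ ℓ(ℓ(4c₀+8) + 2c₀ + 5)`** on inputs of complexity `≤ c₀` (the printed `O(ℓ²)`).
[cite: ChatterjeeTengse2023, Obs. 2.9 (v1: Obs. 17)] -/
theorem complexity_LT_le (c₀ : ℕ) : ∀ (ℓ : ℕ) (u v : Fin ℓ → MvPolynomial σ F),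
    (∀ i, complexity (u i) ≤ c₀) → (∀ i, complexity (v i) ≤ c₀) →
      complexity (BitGadget.LT ℓ u v) ≤ ℓ * (ℓ * (4 * c₀ + 8) + 2 * c₀ + 5)
  | 0, u, v, _, _ => by simpa [BitGadget.LT] using (complexity_C_holds (σ := σ) (0 : F)).le
  | ℓ + 1, u, v, hu, hv => by
    rw [BitGadget.LT]
    have h1 := cx_one_sub (F := F) (u 0)
    have h2 := complexity_mul_le_holds (1 - u 0) (v 0)
    have h3 := complexity_EQ_le (F := F) c₀ ℓ (Fin.tail u) (Fin.tail v) (fun i => hu _) (fun i => hv _)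
    have h4 := complexity_mul_le_holds ((1 - u 0) * v 0) (EQ ℓ (Fin.tail u) (Fin.tail v))
    have h5 := complexity_LT_le c₀ ℓ (Fin.tail u) (Fin.tail v) (fun i => hu _) (fun i => hv _)
    have h6 := complexity_add_le_holds ((1 - u 0) * v 0 * EQ ℓ (Fin.tail u) (Fin.tail v))
      (BitGadget.LT ℓ (Fin.tail u) (Fin.tail v))
    have hu0 := hu 0
    have hv0 := hv 0
    nlinarith

omit [DecidableEq τ] in
/-- **`L(GT_ℓ)`**: the same bound. [cite: ChatterjeeTengse2023, Obs. 2.9 (v1: Obs. 17)] -/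
theorem complexity_GT_le (c₀ : ℕ) (ℓ : ℕ) (u v : Fin ℓ → MvPolynomial σ F)
    (hu : ∀ i, complexity (u i) ≤ c₀) (hv : ∀ i, complexity (v i) ≤ c₀) :
    complexity (GT ℓ u v) ≤ ℓ * (ℓ * (4 * c₀ + 8) + 2 * c₀ + 5) :=
  complexity_LT_le c₀ ℓ v u hv hu

variable {n m δ : ℕ}

omit [DecidableEq τ] in
/-- Gadget inputs: variables and `0/1` constants are free. [cite: Burgisser2000, Def. 2.1] -/
private theorem cx_varVec {L : ℕ} (a : Fin L → τ) (l : Fin L) :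
    complexity (varVec (F := F) a l) ≤ 0 :=
  (complexity_X_holds (k := F) (a l)).le

omit [DecidableEq τ] in
/-- Gadget inputs: variables and `0/1` constants are free. [cite: Burgisser2000, Def. 2.1] -/
private theorem cx_constVec {L : ℕ} (Kb : Fin L → Bool) (l : Fin L) :
    complexity (constVec (F := F) (τ := τ) Kb l) ≤ 0 :=
  (cx_bitVal (σ := τ) (Kb l)).le

omit [DecidableEq τ] in
/-- **`L(pow(i)_k) ≤ 5L + 1`** with the powers of `α` as constants.
[cite: ChatterjeeTengse2023, Lemma 3.5, size of `pow` (v1: Lemma 42; p0015.txt:L86–L96, p0016.txt:L6)] -/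
theorem complexity_kronPow_le {L : ℕ} (a : Fin L → τ) (α : F) (Δ : ℕ) (k : Fin m) :
    complexity (kronPow a α Δ k) ≤ 5 * L + 1 := by
  rw [kronPow]
  set f : Fin L → MvPolynomial τ F :=
    fun l => X (a l) * C (α ^ (2 ^ (l : ℕ) * Δ ^ (k : ℕ))) + (1 - X (a l)) with hf
  have hfac : ∀ l : Fin L, complexity (f l) ≤ 4 := by
    intro l
    have h1 := complexity_mul_le_holds (X (a l) : MvPolynomial τ F) (C (α ^ (2 ^ (l : ℕ) * Δ ^ (k : ℕ))))
    have h2 := cx_one_sub (F := F) (X (a l) : MvPolynomial τ F)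
    have h3 := complexity_add_le_holds (X (a l) * C (α ^ (2 ^ (l : ℕ) * Δ ^ (k : ℕ))) : MvPolynomial τ F)
      (1 - X (a l))
    have h4 := complexity_X_holds (k := F) (a l)
    have h5 := complexity_C_holds (σ := τ) (α ^ (2 ^ (l : ℕ) * Δ ^ (k : ℕ)))
    simp only [hf]
    omega
  have hprod := complexity_finset_prod_le (Finset.univ : Finset (Fin L)) f
  have hsum : ∑ l : Fin L, complexity (f l) ≤ 4 * L := by
    calc _ ≤ ∑ _l : Fin L, 4 := Finset.sum_le_sum fun l _ => hfac l
      _ = 4 * L := by simp [mul_comm]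
  have hC := complexity_C_holds (σ := τ) (α ^ Δ ^ (k : ℕ))
  have hmul := complexity_mul_le_holds (C (α ^ Δ ^ (k : ℕ)) : MvPolynomial τ F) (∏ l : Fin L, f l)
  rw [Finset.card_univ, Fintype.card_fin] at hprod
  have hgoal : complexity (C (α ^ Δ ^ (k : ℕ)) * ∏ l : Fin L, f l) ≤ 5 * L + 1 := by omega
  simpa [hf] using hgoal

/-- **The size bound for the skeleton with placeholder rows** (`L = n·δ`, `D = 2^δ`): an explicit
polynomial in `n, δ, 2^δ`. [cite: ChatterjeeTengse2023, Lemma 3.5, size count (v1: Lemma 42; p0016.txt:L5–L8)] -/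
def skelBound (n δ : ℕ) : ℕ :=
  let L := n * δ
  let cLT := L * (L * 8 + 5)
  let cRow := cLT + 8 * L + 3
  2 * (cLT + 2) + (n * (δ * (cRow + 2 ^ δ + 4) + δ) + n) + (cLT + 4 + 8 * L + 1) + 4

omit [DecidableEq τ] in
/-- **`L(skeleton with placeholder rows p_t) ≤ skelBound n δ`.**
[cite: ChatterjeeTengse2023, Lemma 3.5, size count (v1: Lemma 42; p0016.txt:L5–L8)] -/
theorem complexity_encoderSkeleton_le (x : Fin n → τ) (a b : Fin (n * δ) → τ)
    (Kb : Fin (n * δ) → Bool) (p : Fin n → τ) :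
    complexity (encoderSkeleton x a b Kb (fun t => (X (p t) : MvPolynomial τ F))) ≤ skelBound n δ := by
  -- gadgets on free inputs
  have hLT : complexity (LT (n * δ) (varVec (F := F) a) (constVec Kb)) ≤ (n * δ) * ((n * δ) * 8 + 5) := by
    simpa using complexity_LT_le (F := F) 0 (n * δ) (varVec a) (constVec Kb) (cx_varVec a) (cx_constVec Kb)
  have hEQ : complexity (EQ (n * δ) (varVec (F := F) a) (constVec Kb)) ≤ (n * δ) * 8 := by
    simpa using complexity_EQ_le (F := F) 0 (n * δ) (varVec a) (constVec Kb) (cx_varVec a) (cx_constVec Kb)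
  have hGTa : complexity (GT (n * δ) (varVec (F := F) a) (constVec Kb)) ≤ (n * δ) * ((n * δ) * 8 + 5) := by
    simpa using complexity_GT_le (F := F) 0 (n * δ) (varVec a) (constVec Kb) (cx_varVec a) (cx_constVec Kb)
  have hGTb : complexity (GT (n * δ) (varVec (F := F) b) (constVec Kb)) ≤ (n * δ) * ((n * δ) * 8 + 5) := by
    simpa using complexity_GT_le (F := F) 0 (n * δ) (varVec b) (constVec Kb) (cx_varVec b) (cx_constVec Kb)
  have hEQab : complexity (EQ (n * δ) (varVec (F := F) a) (varVec b)) ≤ (n * δ) * 8 := by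
    simpa using complexity_EQ_le (F := F) 0 (n * δ) (varVec a) (varVec b) (cx_varVec a) (cx_varVec b)
  have hactA : complexity (actPoly (F := F) a Kb) ≤ (n * δ) * ((n * δ) * 8 + 5) + 2 :=
    (cx_one_sub _).trans (by omega)
  have hactB : complexity (actPoly (F := F) b Kb) ≤ (n * δ) * ((n * δ) * 8 + 5) + 2 :=
    (cx_one_sub _).trans (by omega)
  -- rows
  have hrow : ∀ t, complexity (rowPolyG x a Kb (fun t => (X (p t) : MvPolynomial τ F)) t) ≤
      (n * δ) * ((n * δ) * 8 + 5) + 8 * (n * δ) + 3 := by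
    intro t
    rw [rowPolyG]
    have h1 := complexity_mul_le_holds (LT (n * δ) (varVec (F := F) a) (constVec Kb)) (X (p t))
    have h2 := complexity_mul_le_holds (EQ (n * δ) (varVec (F := F) a) (constVec Kb)) (X (x t))
    have h3 := complexity_add_le_holds (LT (n * δ) (varVec (F := F) a) (constVec Kb) * X (p t))
      (EQ (n * δ) (varVec (F := F) a) (constVec Kb) * X (x t))
    have h4 := complexity_X_holds (k := F) (p t)
    have h5 := complexity_X_holds (k := F) (x t)
    omega
  -- column powers
  have hcol : ∀ t, complexity (colPow b (rowPolyG x a Kb (fun t => (X (p t) : MvPolynomial τ F)) t) t) ≤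
      δ * ((n * δ) * ((n * δ) * 8 + 5) + 8 * (n * δ) + 3 + 2 ^ δ + 4) + δ := by
    intro t
    have h7 := hrow t
    rw [colPow]
    set R := rowPolyG x a Kb (fun t => (X (p t) : MvPolynomial τ F)) t with hR
    have hfac : ∀ β : Fin δ, complexity ((X (b (finProdFinEquiv (t, β))) * R ^ (2 ^ (β : ℕ)) +
        (1 - X (b (finProdFinEquiv (t, β))))) : MvPolynomial τ F) ≤
        (n * δ) * ((n * δ) * 8 + 5) + 8 * (n * δ) + 3 + 2 ^ δ + 4 := by
      intro β
      have h1 := cx_pow (F := F) R (2 ^ (β : ℕ))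
      have h2 : 2 ^ (β : ℕ) ≤ 2 ^ δ := Nat.pow_le_pow_right (by norm_num) β.isLt.le
      have h3 := complexity_mul_le_holds (X (b (finProdFinEquiv (t, β))) : MvPolynomial τ F) (R ^ (2 ^ (β : ℕ)))
      have h4 := cx_one_sub (F := F) (X (b (finProdFinEquiv (t, β))) : MvPolynomial τ F)
      have h5 := complexity_add_le_holds (X (b (finProdFinEquiv (t, β))) * R ^ (2 ^ (β : ℕ)) : MvPolynomial τ F)
        (1 - X (b (finProdFinEquiv (t, β))))
      have h6 := complexity_X_holds (k := F) (b (finProdFinEquiv (t, β)))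
      omega
    have hprod := complexity_finset_prod_le (Finset.univ : Finset (Fin δ))
      (fun β => ((X (b (finProdFinEquiv (t, β))) * R ^ (2 ^ (β : ℕ)) +
        (1 - X (b (finProdFinEquiv (t, β))))) : MvPolynomial τ F))
    rw [Finset.card_univ, Fintype.card_fin] at hprod
    refine hprod.trans ?_
    have := Finset.sum_le_sum (s := (Finset.univ : Finset (Fin δ))) fun β _ => hfac β
    rw [Finset.sum_const, Finset.card_univ, Fintype.card_fin, smul_eq_mul] at this
    omega
  have hcore : complexity (∏ t : Fin n, colPow b (rowPolyG x a Kb (fun t => (X (p t) : MvPolynomial τ F)) t) t) ≤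
      n * (δ * ((n * δ) * ((n * δ) * 8 + 5) + 8 * (n * δ) + 3 + 2 ^ δ + 4) + δ) + n := by
    have hprod := complexity_finset_prod_le (Finset.univ : Finset (Fin n))
      (fun t => colPow b (rowPolyG x a Kb (fun t => (X (p t) : MvPolynomial τ F)) t) t)
    rw [Finset.card_univ, Fintype.card_fin] at hprod
    refine hprod.trans ?_
    have := Finset.sum_le_sum (s := (Finset.univ : Finset (Fin n))) fun t _ => hcol t
    rw [Finset.sum_const, Finset.card_univ, Fintype.card_fin, smul_eq_mul] at this
    omega
  -- assembly
  rw [encoderSkeleton]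
  have h1 := complexity_mul_le_holds (actPoly (F := F) a Kb) (actPoly b Kb)
  have h2 := complexity_mul_le_holds (actPoly (F := F) a Kb * actPoly b Kb)
    (∏ t : Fin n, colPow b (rowPolyG x a Kb (fun t => (X (p t) : MvPolynomial τ F)) t) t)
  have h3 := cx_one_sub (F := F) (actPoly (F := F) b Kb)
  have h4 := complexity_mul_le_holds (1 - actPoly (F := F) b Kb) (EQ (n * δ) (varVec (F := F) a) (varVec b))
  have h5 := complexity_add_le_holds
    (actPoly (F := F) a Kb * actPoly b Kb *
      ∏ t : Fin n, colPow b (rowPolyG x a Kb (fun t => (X (p t) : MvPolynomial τ F)) t) t)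
    ((1 - actPoly (F := F) b Kb) * EQ (n * δ) (varVec (F := F) a) (varVec b))
  simp only [skelBound]
  omega

end Complexity


/-! ### §3 The circuit: `pow` prefix, `n` substituted row circuits, the skeleton on top -/

section Circuit

variable {n m δ w : ℕ}

/-- **Layout for the circuit**: annihilator variables `x`, index blocks `a, b`, PLACEHOLDER
variables `p` (one per row value, substituted away) and the images `ws` of the row circuits'
workspace variables — all distinct. [cite: ChatterjeeTengse2023, Lemma 3.5 (v1: Lemma 42; p0015.txt:L80–L99)] -/
structure CircLayout (x : Fin n → τ) (a b : Fin (n * δ) → τ) (p : Fin n → τ) (ws : Fin w → τ) : Prop where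
  /-- `x, a, b, p, ws` are pairwise distinct variables -/
  inj : Function.Injective (Sum.elim (Sum.elim x (Sum.elim a b)) (Sum.elim p ws))

namespace CircLayout

variable {x : Fin n → τ} {a b : Fin (n * δ) → τ} {p : Fin n → τ} {ws : Fin w → τ}
  (lay : CircLayout x a b p ws)
include lay

omit [DecidableEq τ] in
/-- The encoder layout underneath. [cite: ChatterjeeTengse2023, Lemma 3.5 (v1: Lemma 42)] -/
theorem toEncLayout : EncLayout x a b :=
  ⟨fun u v h => Sum.inl_injective (@lay.inj (Sum.inl u) (Sum.inl v) (by
    rcases u with u | u | u <;> rcases v with v | v | v <;> simpa using h))⟩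

omit [DecidableEq τ] in
/-- `p` is injective (private: a generic injectivity shape). [cite: ChatterjeeTengse2023, Lemma 3.5 (v1: Lemma 42)] -/
private theorem p_inj : Function.Injective p := fun t t' h => by
  have := @lay.inj (Sum.inr (Sum.inl t)) (Sum.inr (Sum.inl t')) (by simpa using h)
  simpa using this

omit [DecidableEq τ] in
/-- `ws` is injective (private: a generic injectivity shape). [cite: ChatterjeeTengse2023, Lemma 3.5 (v1: Lemma 42)] -/
private theorem ws_inj : Function.Injective ws := fun t t' h => by
  have := @lay.inj (Sum.inr (Sum.inr t)) (Sum.inr (Sum.inr t')) (by simpa using h)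
  simpa using this

omit [DecidableEq τ] in
/-- `p` misses `x`. [cite: ChatterjeeTengse2023, Lemma 3.5 (v1: Lemma 42)] -/
theorem p_ne_x (t : Fin n) (t' : Fin n) : p t ≠ x t' := fun h => by
  have := @lay.inj (Sum.inr (Sum.inl t)) (Sum.inl (Sum.inl t')) (by simpa using h)
  simp at this

omit [DecidableEq τ] in
/-- `p` misses `a`. [cite: ChatterjeeTengse2023, Lemma 3.5 (v1: Lemma 42)] -/
theorem p_ne_a (t : Fin n) (l : Fin (n * δ)) : p t ≠ a l := fun h => by
  have := @lay.inj (Sum.inr (Sum.inl t)) (Sum.inl (Sum.inr (Sum.inl l))) (by simpa using h)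
  simp at this

omit [DecidableEq τ] in
/-- `p` misses `b`. [cite: ChatterjeeTengse2023, Lemma 3.5 (v1: Lemma 42)] -/
theorem p_ne_b (t : Fin n) (l : Fin (n * δ)) : p t ≠ b l := fun h => by
  have := @lay.inj (Sum.inr (Sum.inl t)) (Sum.inl (Sum.inr (Sum.inr l))) (by simpa using h)
  simp at this

omit [DecidableEq τ] in
/-- `ws` misses `a`. [cite: ChatterjeeTengse2023, Lemma 3.5 (v1: Lemma 42)] -/
theorem ws_ne_a (ω : Fin w) (l : Fin (n * δ)) : ws ω ≠ a l := fun h => by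
  have := @lay.inj (Sum.inr (Sum.inr ω)) (Sum.inl (Sum.inr (Sum.inl l))) (by simpa using h)
  simp at this

end CircLayout

variable (a : Fin (n * δ) → τ) (α : F) (Δ : ℕ)

/-- A smallest fan-in-two circuit for `pow(i)_k`. [cite: ChatterjeeTengse2023, Lemma 3.5, circuits `C_ℓ(α)` / `pow` (v1: Lemma 42; p0015.txt:L86–L96)] -/
def powCirc (k : Fin m) : ArithCircuit F τ :=
  Classical.choose (ArithCircuit.exists_computes_size_eq_complexity (kronPow (m := m) a α Δ k))

omit [DecidableEq τ] in
/-- Its specification. [cite: ChatterjeeTengse2023, Lemma 3.5 (v1: Lemma 42; p0015.txt:L86–L96)] -/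
theorem powCirc_spec (k : Fin m) :
    (powCirc a α Δ k).IsFanInTwo ∧ (powCirc a α Δ k).Computes (kronPow a α Δ k) ∧
      (powCirc a α Δ k).size = complexity (kronPow (m := m) a α Δ k) :=
  Classical.choose_spec (ArithCircuit.exists_computes_size_eq_complexity (kronPow (m := m) a α Δ k))

/-- The list of the `m` coordinate circuits of `pow`. [cite: ChatterjeeTengse2023, Lemma 3.5 (v1: Lemma 42; p0015.txt:L86–L96)] -/
def powList (m : ℕ) : List (ArithCircuit F τ) := List.ofFn fun k : Fin m => powCirc a α Δ k

/-- **Stage A**: the juxtaposed `pow` circuits, as projection-free gates.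
[cite: ChatterjeeTengse2023, Lemma 3.5 (v1: Lemma 42; p0015.txt:L86–L96)] -/
def stageA (m : ℕ) : List (ProjCircuit.Gate F τ) :=
  (ArithCircuit.juxtGates (powList a α Δ m)).map ProjCircuit.Gate.arith

/-- The stable operand reading `pow(i)_k` off stage A. [cite: ChatterjeeTengse2023, Lemma 3.5 (v1: Lemma 42)] -/
def opA (k : Fin m) : ArithCircuit.Operand F τ :=
  (ArithCircuit.juxtOuts (powList a α Δ m))[(k : ℕ)]'(by simp [powList])

omit [DecidableEq τ] in
/-- **Stage A computes `pow`**: the `k`-th operand reads `kronPow k`, whatever follows.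
[cite: ChatterjeeTengse2023, Lemma 3.5 (v1: Lemma 42; p0016.txt:L1)] -/
theorem eval_opA [DecidableEq τ] (k : Fin m) (vs : List (MvPolynomial τ F)) :
    (opA a α Δ k).eval (ProjCircuit.gateValues (stageA a α Δ m) ++ vs) = kronPow a α Δ k := by
  rw [stageA, ProjCircuit.gateValues_map_arith, opA,
    ArithCircuit.eval_juxtOuts _ _ (by simp [powList]) vs]
  simp only [powList, List.getElem_ofFn]
  exact (powCirc_spec a α Δ _).2.1

omit [DecidableEq τ] in
/-- Stage A: size. [cite: ChatterjeeTengse2023, Lemma 3.5, size count (v1: Lemma 42; p0016.txt:L5–L8)] -/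
theorem length_stageA : (stageA a α Δ m).length ≤ m * (5 * (n * δ) + 1) := by
  rw [stageA, List.length_map, ArithCircuit.length_juxtGates, powList, List.map_ofFn, List.sum_ofFn]
  calc ∑ k : Fin m, (ArithCircuit.size ∘ fun k => powCirc (F := F) a α Δ k) k
      ≤ ∑ _k : Fin m, (5 * (n * δ) + 1) := Finset.sum_le_sum fun k _ => by
        simp only [Function.comp_apply]
        rw [(powCirc_spec a α Δ k).2.2]
        exact complexity_kronPow_le a α Δ k
    _ = m * (5 * (n * δ) + 1) := by simp

omit [DecidableEq τ] in
/-- Stage A: fan-in two, no projection gates. [cite: ChatterjeeTengse2023, Lemma 3.5 (v1: Lemma 42)] -/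
theorem stageA_spec : ∀ g ∈ stageA a α Δ m, g.fanIn ≤ 2 ∧ ∃ g', g = ProjCircuit.Gate.arith g' := by
  intro g hg
  rw [stageA, List.mem_map] at hg
  obtain ⟨g', hg', rfl⟩ := hg
  refine ⟨?_, g', rfl⟩
  have h := ArithCircuit.fanIn_juxtGates (L := powList (F := F) a α Δ m) (fun Q hQ => ?_) g' hg'
  · simpa [ProjCircuit.Gate.fanIn] using h
  · simp only [powList, List.mem_ofFn] at hQ
    obtain ⟨k, rfl⟩ := hQ
    exact (powCirc_spec a α Δ k).1

variable (ws : Fin w → τ) (dflt : τ) (Q : Fin n → ProjCircuit F (Fin m ⊕ Fin w))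

/-- The operands substituted into a row circuit: `z_k ↦ pow(i)_k` (stage A), workspace `↦ ws`.
[cite: ChatterjeeTengse2023, Lemma 3.5, `C_G(pow(i))` (v1: Lemma 42; p0015.txt:L97)] -/
def rowOperands : Fin m ⊕ Fin w → ArithCircuit.Operand F τ :=
  Sum.elim (fun k => opA a α Δ k) (fun ω => .var (ws ω))

/-- Relabelling of projected variables: workspace `↦ ws` (inputs are never projected by the
row circuits, their image `dflt` is irrelevant). [cite: ChatterjeeTengse2023, Lemma 3.5 (v1: Lemma 42)] -/
def rowRelabel : Fin m ⊕ Fin w → τ := Sum.elim (fun _ => dflt) ws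

/-- The substitution realised by a row copy: `z_k ↦ pow(i)_k`, workspace `↦ X (ws ω)`.
[cite: ChatterjeeTengse2023, Lemma 3.5 (v1: Lemma 42; p0015.txt:L97)] -/
def rowSubst : Fin m ⊕ Fin w → MvPolynomial τ F :=
  Sum.elim (fun k => kronPow a α Δ k) (fun ω => X (ws ω))

/-- **Stage B**: stage A followed by the first `t` substituted row circuits.
[cite: ChatterjeeTengse2023, Lemma 3.5, `ROW` (v1: Lemma 42; p0015.txt:L97)] -/
def stageB : ℕ → List (ProjCircuit.Gate F τ)
  | 0 => stageA a α Δ m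
  | t + 1 =>
    if h : t < n then
      ((Q ⟨t, h⟩).subst (stageB t) (rowRelabel ws dflt) (rowOperands a α Δ ws)).gates
    else stageB t

/-- The stable operand reading the value of row circuit `t` (truncated past its own gates).
[cite: ChatterjeeTengse2023, Lemma 3.5, `ROW(i)_a` (v1: Lemma 42; p0016.txt:L2–L3)] -/
def rowOut (t : Fin n) : ArithCircuit.Operand F τ :=
  (((Q t).subst (stageB a α Δ ws dflt Q t) (rowRelabel ws dflt) (rowOperands a α Δ ws)).output).truncate
    (stageB a α Δ ws dflt Q (t + 1)).length

omit [DecidableEq τ] in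
/-- Stage B unfolds at a row index. [folklore] -/
private theorem stageB_succ (t : Fin n) :
    stageB a α Δ ws dflt Q ((t : ℕ) + 1) =
      ((Q t).subst (stageB a α Δ ws dflt Q t) (rowRelabel ws dflt) (rowOperands a α Δ ws)).gates := by
  simp [stageB, t.isLt]

omit [DecidableEq τ] in
/-- Stage B is frozen past `n`. [folklore] -/
private theorem stageB_of_le {t : ℕ} (ht : n ≤ t) : stageB a α Δ ws dflt Q t = stageB a α Δ ws dflt Q n := by
  induction t with
  | zero =>
    have : n = 0 := by omega
    subst this; rfl
  | succ t ih =>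
    rcases Nat.lt_or_ge t n with h | h
    · have : n = t + 1 := by omega
      subst this; rfl
    · rw [show stageB a α Δ ws dflt Q (t + 1) = stageB a α Δ ws dflt Q t by simp [stageB, Nat.not_lt.2 h],
        ih h]

omit [DecidableEq τ] in
/-- Stage B grows by appending. [folklore] -/
private theorem stageB_prefix {t t' : ℕ} (h : t ≤ t') :
    ∃ rest, stageB a α Δ ws dflt Q t' = stageB a α Δ ws dflt Q t ++ rest := by
  induction t' with
  | zero =>
    have : t = 0 := by omega
    subst this; exact ⟨[], by simp⟩
  | succ t' ih =>
    rcases Nat.lt_or_ge t (t' + 1) with hlt | hge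
    · obtain ⟨rest, hrest⟩ := ih (by omega)
      by_cases ht' : t' < n
      · refine ⟨rest ++ (Q ⟨t', ht'⟩).gates.map
          (ProjCircuit.Gate.subst (rowRelabel ws dflt) (rowOperands a α Δ ws) (stageB a α Δ ws dflt Q t').length), ?_⟩
        simp [stageB, ht', ProjCircuit.subst, hrest]
      · exact ⟨rest, by simp [stageB, ht', hrest]⟩
    · have : t = t' + 1 := by omega
      subst this; exact ⟨[], by simp⟩

/-- Gate values of an extension extend the gate values. [folklore] -/
private theorem gateValues_prefix (gs rest : List (ProjCircuit.Gate F τ)) :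
    ∃ vs, ProjCircuit.gateValues (gs ++ rest) = ProjCircuit.gateValues gs ++ vs := by
  induction rest using List.reverseRecOn with
  | nil => exact ⟨[], by simp⟩
  | append_singleton rest g ih =>
    obtain ⟨vs, hvs⟩ := ih
    refine ⟨vs ++ [g.eval (ProjCircuit.gateValues (gs ++ rest))], ?_⟩
    rw [← List.append_assoc, ProjCircuit.gateValues_append_singleton, hvs, List.append_assoc]

/-- **The substituted inputs read `pow` and the workspace** against stage B at any step.
[cite: ChatterjeeTengse2023, Lemma 3.5 (v1: Lemma 42; p0015.txt:L97)] -/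
theorem eval_rowOperands (t : ℕ) (i : Fin m ⊕ Fin w) (vs : List (MvPolynomial τ F)) :
    (rowOperands a α Δ ws i).eval (ProjCircuit.gateValues (stageB a α Δ ws dflt Q t) ++ vs) =
      rowSubst a α Δ ws i := by
  cases i with
  | inl k =>
    obtain ⟨rest, hrest⟩ := stageB_prefix a α Δ ws dflt Q (Nat.zero_le t)
    obtain ⟨vs', hvs'⟩ := gateValues_prefix (stageB a α Δ ws dflt Q 0) rest
    rw [rowOperands, Sum.elim_inl, hrest, hvs', List.append_assoc]
    exact eval_opA a α Δ k _
  | inr ω => rfl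

variable {a α Δ ws dflt Q} {x : Fin n → τ} {b : Fin (n * δ) → τ} {p : Fin n → τ}

omit [DecidableEq τ] in
/-- An algebra map fixing the row block fixes `pow`. [cite: ChatterjeeTengse2023, Lemma 3.5 (v1: Lemma 42)] -/
theorem aeval_kronPow_of_fix (f : τ → MvPolynomial τ F) (hf : ∀ l, f (a l) = X (a l)) (k : Fin m) :
    aeval f (kronPow a α Δ k) = kronPow a α Δ k := by
  simp only [kronPow, map_mul, map_prod, map_add, map_sub, map_one, aeval_C, aeval_X, hf, algebraMap_eq]

/-- **The row circuits are substitution-compatible**: they project only workspace variables,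
which the substitution maps to themselves (`ws`) and which occur in no substituted `pow`.
[cite: ChatterjeeTengse2023, Lemma 3.5 (v1: Lemma 42; p0015.txt:L97)] -/
theorem substCompat_row (lay : CircLayout x a b p ws) (t : Fin n)
    (hQp : (Q t).projVars ⊆ Set.range Sum.inr) :
    (Q t).SubstCompat (rowRelabel ws dflt) (rowSubst (F := F) a α Δ ws) := by
  intro i hi c v
  obtain ⟨ω, rfl⟩ := hQp hi
  refine aeval_projVar_comm (h := rowSubst (F := F) a α Δ ws) (e := rowRelabel ws dflt)
    (i := Sum.inr ω) c rfl (fun i' hi' => ?_) v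
  cases i' with
  | inl k =>
    change projVar (ws ω) c (kronPow a α Δ k) = kronPow a α Δ k
    rw [projVar]
    exact aeval_kronPow_of_fix _ (fun l => by simp [(lay.ws_ne_a ω l).symm]) k
  | inr ω' =>
    have hne : ws ω' ≠ ws ω := fun h => hi' (by rw [lay.ws_inj h])
    change projVar (ws ω) c (X (ws ω')) = X (ws ω')
    exact projVar_X_of_ne hne c

/-- **Row copy `t` computes `(G t)(pow(i))`**, read by its stable operand against any later stage.
[cite: ChatterjeeTengse2023, Lemma 3.5, `ROW(i)_a = … g_a(pow(i)) …` (v1: Lemma 42; p0016.txt:L2–L3)] -/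
theorem eval_rowOut (lay : CircLayout x a b p ws) {G : Fin n → MvPolynomial (Fin m) F}
    (hQc : ∀ t, (Q t).Computes (rename Sum.inl (G t)))
    (hQp : ∀ t, (Q t).projVars ⊆ Set.range Sum.inr) (t : Fin n) {t' : ℕ} (ht : (t : ℕ) + 1 ≤ t')
    (vs : List (MvPolynomial τ F)) :
    (rowOut a α Δ ws dflt Q t).eval (ProjCircuit.gateValues (stageB a α Δ ws dflt Q t') ++ vs) =
      gKron a α Δ (G t) := by
  obtain ⟨rest, hrest⟩ := stageB_prefix a α Δ ws dflt Q ht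
  obtain ⟨vs', hvs'⟩ := gateValues_prefix (stageB a α Δ ws dflt Q ((t : ℕ) + 1)) rest
  rw [hrest, hvs', List.append_assoc, rowOut]
  have hlen : (stageB a α Δ ws dflt Q ((t : ℕ) + 1)).length =
      (ProjCircuit.gateValues (stageB a α Δ ws dflt Q ((t : ℕ) + 1))).length :=
    (ProjCircuit.gateValues_length _).symm
  rw [hlen, ArithCircuit.Operand.eval_truncate_append]
  have h := ProjCircuit.eval_subst (Q t) (stageB a α Δ ws dflt Q t) (e := rowRelabel ws dflt)
    (ρ := rowOperands a α Δ ws) (h := rowSubst a α Δ ws)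
    (fun i vs => eval_rowOperands a α Δ ws dflt Q t i vs) (substCompat_row lay t (hQp t))
  rw [ProjCircuit.eval, ← stageB_succ] at h
  rw [h, show (Q t).eval = rename Sum.inl (G t) from hQc t, aeval_rename, gKron]
  rfl

/-- A smallest fan-in-two circuit for the skeleton with placeholder rows. [cite: ChatterjeeTengse2023, Lemma 3.5, `M̃_G` (v1: Lemma 42; p0015.txt:L99)] -/
def skelCirc (x : Fin n → τ) (a b : Fin (n * δ) → τ) (Kb : Fin (n * δ) → Bool) (p : Fin n → τ) :
    ArithCircuit F τ :=
  Classical.choose (ArithCircuit.exists_computes_size_eq_complexity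
    (encoderSkeleton x a b Kb (fun t => (X (p t) : MvPolynomial τ F))))

omit [DecidableEq τ] in
/-- Its specification. [cite: ChatterjeeTengse2023, Lemma 3.5 (v1: Lemma 42; p0015.txt:L99)] -/
theorem skelCirc_spec (x : Fin n → τ) (a b : Fin (n * δ) → τ) (Kb : Fin (n * δ) → Bool) (p : Fin n → τ) :
    (skelCirc (F := F) x a b Kb p).IsFanInTwo ∧
      (skelCirc (F := F) x a b Kb p).Computes (encoderSkeleton x a b Kb (fun t => (X (p t) : MvPolynomial τ F))) ∧
      (skelCirc (F := F) x a b Kb p).size =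
        complexity (encoderSkeleton x a b Kb (fun t => (X (p t) : MvPolynomial τ F))) :=
  Classical.choose_spec (ArithCircuit.exists_computes_size_eq_complexity
    (encoderSkeleton x a b Kb (fun t => (X (p t) : MvPolynomial τ F))))

/-- The operands substituted into the skeleton: placeholder `p_t ↦` output of row copy `t`,
every other variable `↦` itself. [cite: ChatterjeeTengse2023, Lemma 3.5 (v1: Lemma 42; p0015.txt:L99)] -/
def skelOperands (a : Fin (n * δ) → τ) (α : F) (Δ : ℕ) (ws : Fin w → τ) (dflt : τ)
    (Q : Fin n → ProjCircuit F (Fin m ⊕ Fin w)) (p : Fin n → τ) : τ → ArithCircuit.Operand F τ :=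
  onBlock p (fun t => rowOut a α Δ ws dflt Q t) (fun v => .var v)

/-- **The encoder circuit `M̃_G`**: stages A and B, then the skeleton with its placeholders
substituted by the row outputs. [cite: ChatterjeeTengse2023, Lemma 3.5 (v1: Lemma 42; p0015.txt:L80–L102)] -/
def encCircuit (x : Fin n → τ) (a b : Fin (n * δ) → τ) (Kb : Fin (n * δ) → Bool) (p : Fin n → τ)
    (α : F) (Δ : ℕ) (ws : Fin w → τ) (dflt : τ) (Q : Fin n → ProjCircuit F (Fin m ⊕ Fin w)) :
    ProjCircuit F τ :=
  (ProjCircuit.ofArithCircuit (skelCirc (F := F) x a b Kb p)).subst (stageB a α Δ ws dflt Q n) id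
    (skelOperands a α Δ ws dflt Q p)

/-- **`M̃_G` computes the encoder skeleton at the pre-specialised rows `(G t)(pow(i))`.**
[cite: ChatterjeeTengse2023, Lemma 3.5 "`M̃_G(x, i, j) = M̃[i, e^{(j)}]`" (v1: Lemma 42; p0015.txt:L80–L102)] -/
theorem eval_encCircuit (lay : CircLayout x a b p ws) (Kb : Fin (n * δ) → Bool)
    {G : Fin n → MvPolynomial (Fin m) F} (hQc : ∀ t, (Q t).Computes (rename Sum.inl (G t)))
    (hQp : ∀ t, (Q t).projVars ⊆ Set.range Sum.inr) :
    (encCircuit x a b Kb p α Δ ws dflt Q).eval = encoderSkeleton x a b Kb (fun t => gKron a α Δ (G t)) := by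
  have hρ : ∀ v vs, (skelOperands a α Δ ws dflt Q p v).eval
      (ProjCircuit.gateValues (stageB a α Δ ws dflt Q n) ++ vs) =
      onBlock p (fun t => gKron a α Δ (G t)) X v := by
    intro v vs
    by_cases hv : ∃ t, p t = v
    · obtain ⟨t, rfl⟩ := hv
      rw [skelOperands, onBlock_blk lay.p_inj, onBlock_blk lay.p_inj]
      exact eval_rowOut lay hQc hQp t (Nat.succ_le_of_lt t.isLt) vs
    · have hv' : ∀ t, p t ≠ v := fun t h => hv ⟨t, h⟩
      rw [skelOperands, onBlock_of_ne hv', onBlock_of_ne hv']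
      rfl
  have hcompat : (ProjCircuit.ofArithCircuit (skelCirc (F := F) x a b Kb p)).SubstCompat id
      (onBlock p (fun t => gKron a α Δ (G t)) X) := by
    intro i hi
    obtain ⟨c, u, hg⟩ := hi
    simp [ProjCircuit.ofArithCircuit] at hg
  rw [encCircuit, ProjCircuit.eval_subst _ _ hρ hcompat, ProjCircuit.eval_ofArithCircuit,
    (skelCirc_spec x a b Kb p).2.1]
  -- the substitution fixes `x, a, b` and sends `p t ↦ (G t)(pow(i))`
  have hx : ∀ t, onBlock p (fun t => gKron a α Δ (G t)) X (x t) = (X (x t) : MvPolynomial τ F) :=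
    fun t => onBlock_of_ne (fun t' => lay.p_ne_x t' t) _ _
  have ha : ∀ l, onBlock p (fun t => gKron a α Δ (G t)) X (a l) = (X (a l) : MvPolynomial τ F) :=
    fun l => onBlock_of_ne (fun t' => lay.p_ne_a t' l) _ _
  have hb : ∀ l, onBlock p (fun t => gKron a α Δ (G t)) X (b l) = (X (b l) : MvPolynomial τ F) :=
    fun l => onBlock_of_ne (fun t' => lay.p_ne_b t' l) _ _
  have hp : ∀ t, onBlock p (fun t => gKron a α Δ (G t)) X (p t) = gKron a α Δ (G t) :=
    fun t => onBlock_blk lay.p_inj _ _ t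
  have hvarA : (fun l => aeval (onBlock p (fun t => gKron a α Δ (G t)) X) (varVec (F := F) a l)) =
      varVec (F := F) a := funext fun l => by rw [varVec, aeval_X, ha]
  have hvarB : (fun l => aeval (onBlock p (fun t => gKron a α Δ (G t)) X) (varVec (F := F) b l)) =
      varVec (F := F) b := funext fun l => by rw [varVec, aeval_X, hb]
  have hconst : (fun l => aeval (onBlock p (fun t => gKron a α Δ (G t)) X) (constVec (F := F) (τ := τ) Kb l)) =
      constVec (F := F) Kb := funext fun l => by
    cases h : Kb l <;> simp [constVec, bitVal, h]
  simp only [encoderSkeleton, actPoly, rowPolyG, colPow, map_add, map_mul, map_sub, map_one, map_prod,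
    map_pow, aeval_EQ, aeval_LT, aeval_GT, hvarA, hvarB, hconst, aeval_X, hx, hb, hp]

/-- **Size of `M̃_G`: `n` copies of the row circuits plus a polynomial** (stage A
`≤ m(5L+1)`, the skeleton `≤ skelBound n δ`; the source: "`O((nd)³ + n·size(C_G))`").
[cite: ChatterjeeTengse2023, Lemma 3.5, size count (v1: Lemma 42; p0016.txt:L5–L8)] -/
theorem size_encCircuit_le (Kb : Fin (n * δ) → Bool) {s : ℕ} (hQs : ∀ t, (Q t).size ≤ s) :
    (encCircuit x a b Kb p α Δ ws dflt Q).size ≤ n * s + (m * (5 * (n * δ) + 1) + skelBound n δ) := by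
  have hB : ∀ t, t ≤ n → (stageB a α Δ ws dflt Q t).length ≤ t * s + m * (5 * (n * δ) + 1) := by
    intro t
    induction t with
    | zero => intro _; simpa [stageB] using length_stageA (n := n) a α Δ
    | succ t ih =>
      intro ht
      have hlt : t < n := by omega
      rw [stageB_succ a α Δ ws dflt Q ⟨t, hlt⟩]
      have := ih (by omega)
      have hs := hQs ⟨t, hlt⟩
      simp only [ProjCircuit.subst, List.length_append, List.length_map]
      rw [show (Q ⟨t, hlt⟩).gates.length = (Q ⟨t, hlt⟩).size from rfl]
      nlinarith
  rw [encCircuit, ProjCircuit.size_subst, ProjCircuit.size_ofArithCircuit, (skelCirc_spec x a b Kb p).2.2]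
  have h1 := hB n le_rfl
  have h2 := complexity_encoderSkeleton_le (F := F) x a b Kb p
  omega

omit [DecidableEq τ] in
/-- Fan-in of substituted row gates. [folklore] -/
private theorem fanIn_stageB (hQ2 : ∀ t, (Q t).IsFanInTwo) :
    ∀ t, ∀ g ∈ stageB a α Δ ws dflt Q t, g.fanIn ≤ 2 := by
  intro t
  induction t with
  | zero => exact fun g hg => (stageA_spec a α Δ g hg).1
  | succ t ih =>
    intro g hg
    by_cases ht : t < n
    · rw [stageB_succ a α Δ ws dflt Q ⟨t, ht⟩] at hg
      exact ProjCircuit.isFanInTwo_subst (hQ2 ⟨t, ht⟩) ih _ _ g hg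
    · rw [show stageB a α Δ ws dflt Q (t + 1) = stageB a α Δ ws dflt Q t by simp [stageB, ht]] at hg
      exact ih g hg

/-- **`M̃_G` has fan-in two.** [cite: ChatterjeeTengse2023, Lemma 3.5 (v1: Lemma 42)] -/
theorem isFanInTwo_encCircuit (Kb : Fin (n * δ) → Bool) (hQ2 : ∀ t, (Q t).IsFanInTwo) :
    (encCircuit x a b Kb p α Δ ws dflt Q).IsFanInTwo :=
  ProjCircuit.isFanInTwo_subst (ProjCircuit.isFanInTwo_ofArithCircuit (skelCirc_spec x a b Kb p).1)
    (fanIn_stageB hQ2 n) _ _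

omit [DecidableEq τ] in
/-- Projected variables of substituted row gates. [folklore] -/
private theorem proj_stageB (hQp : ∀ t, (Q t).projVars ⊆ Set.range Sum.inr) :
    ∀ t, ∀ i c u, ProjCircuit.Gate.proj i c u ∈ stageB a α Δ ws dflt Q t → i ∈ Set.range ws := by
  intro t
  induction t with
  | zero =>
    intro i c u hg
    obtain ⟨-, g', hg'⟩ := stageA_spec a α Δ _ hg
    cases hg'
  | succ t ih =>
    intro i c u hg
    by_cases ht : t < n
    · rw [stageB_succ a α Δ ws dflt Q ⟨t, ht⟩] at hg
      simp only [ProjCircuit.subst, List.mem_append, List.mem_map] at hg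
      rcases hg with hg | ⟨g', hg', hge⟩
      · exact ih i c u hg
      · cases g' with
        | arith g => simp [ProjCircuit.Gate.subst] at hge
        | proj i' c' u' =>
          simp only [ProjCircuit.Gate.subst, ProjCircuit.Gate.proj.injEq] at hge
          obtain ⟨rfl, -, -⟩ := hge
          obtain ⟨ω, hω⟩ := hQp ⟨t, ht⟩ ⟨c', u', hg'⟩
          rw [← hω]
          exact ⟨ω, rfl⟩
    · rw [show stageB a α Δ ws dflt Q (t + 1) = stageB a α Δ ws dflt Q t by simp [stageB, ht]] at hg
      exact ih i c u hg

/-- **`M̃_G` projects only the (images of the) workspace variables of the row circuits** — not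
`x`, `a`, `b`: the hygiene the determinant engine (bricks E-c/E-c′/E-d) asks of an encoder.
[cite: ChatterjeeTengse2023, Lemma 3.5 with Prop. 2.28 (v1: Lemma 42, Prop. 36)] -/
theorem projVars_encCircuit_subset (Kb : Fin (n * δ) → Bool)
    (hQp : ∀ t, (Q t).projVars ⊆ Set.range Sum.inr) :
    (encCircuit x a b Kb p α Δ ws dflt Q).projVars ⊆ Set.range ws := by
  rintro i ⟨c, u, hg⟩
  rw [encCircuit] at hg
  simp only [ProjCircuit.subst, List.mem_append, List.mem_map] at hg
  rcases hg with hg | ⟨g', hg', hge⟩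
  · exact proj_stageB hQp n i c u hg
  · simp only [ProjCircuit.ofArithCircuit, List.mem_map] at hg'
    obtain ⟨g'', -, rfl⟩ := hg'
    simp [ProjCircuit.Gate.subst] at hge

/-- **Lemma 3.5 (v1 Lemma 42), circuit form.** Given `n` INPUT-FREE fan-in-two projection
circuits `Q_t` of size `≤ s` computing the outputs `G t` (read on `Fin m ⊕ Fin w`, projecting only
the workspace `Fin w`), and a layout of distinct variables `x, a, b, p, ws` in `τ`, there is a
fan-in-two projection circuit of size `≤ n·s + m(5nδ+1) + skelBound n δ` computing the encoder
skeleton at the rows `(G t)(pow(i))` and projecting only `ws` — whose `matOf` is the padded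
annihilator matrix `M̃` (`det_matOf_encoderSkeleton_prefix`).
[cite: ChatterjeeTengse2023, Lemma 3.5 (v1: Lemma 42; p0015.txt:L74–L102, p0016.txt:L1–L8)] -/
theorem exists_encoderCircuit {x : Fin n → τ} {a b : Fin (n * δ) → τ} {p : Fin n → τ} {ws : Fin w → τ}
    (lay : CircLayout x a b p ws) (dflt : τ) (Kb : Fin (n * δ) → Bool) (α : F) (Δ : ℕ)
    (G : Fin n → MvPolynomial (Fin m) F) (Q : Fin n → ProjCircuit F (Fin m ⊕ Fin w)) {s : ℕ}
    (hQ2 : ∀ t, (Q t).IsFanInTwo) (hQc : ∀ t, (Q t).Computes (rename Sum.inl (G t)))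
    (hQs : ∀ t, (Q t).size ≤ s) (hQp : ∀ t, (Q t).projVars ⊆ Set.range Sum.inr) :
    ∃ C : ProjCircuit F τ, C.IsFanInTwo ∧
      C.Computes (encoderSkeleton x a b Kb (fun t => gKron a α Δ (G t))) ∧
      C.size ≤ n * s + (m * (5 * (n * δ) + 1) + skelBound n δ) ∧
      C.projVars ⊆ Set.range ws :=
  ⟨encCircuit x a b Kb p α Δ ws dflt Q, isFanInTwo_encCircuit Kb hQ2, eval_encCircuit lay Kb hQc hQp,
    size_encCircuit_le Kb hQs, projVars_encCircuit_subset Kb hQp⟩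

end Circuit

/-! ### §4 Variables of the encoder polynomial (interface R5 of the assembly seat: the
determinant engine, Prop. 2.28/2.29, asks that its workspace blocks miss `E.vars`) -/

section Vars

variable {n m δ : ℕ} {x : Fin n → τ} {a b : Fin (n * δ) → τ}

omit [DecidableEq τ] in
/-- `vars(eqBit u v) ⊆ vars u ∪ vars v`. [cite: ChatterjeeTengse2023, Obs. 2.9 (v1: Obs. 17)] -/
private theorem vars_eqBit_subset [DecidableEq τ] (u v : MvPolynomial τ F) :
    ∀ y ∈ (eqBit u v).vars, y ∈ u.vars ∨ y ∈ v.vars := by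
  classical
  intro y hy
  rw [eqBit] at hy
  rcases Finset.mem_union.1 (vars_add_subset _ _ hy) with h | h
  · exact (Finset.mem_union.1 (vars_mul _ _ h))
  · rcases Finset.mem_union.1 (vars_mul _ _ h) with h | h
    · rcases Finset.mem_union.1 (vars_sub_subset _ h) with h | h
      · simp [vars_one] at h
      · exact Or.inl h
    · rcases Finset.mem_union.1 (vars_sub_subset _ h) with h | h
      · simp [vars_one] at h
      · exact Or.inr h

omit [DecidableEq τ] in
/-- **The variables of `EQ`** are among those of its inputs. [cite: ChatterjeeTengse2023, Obs. 2.9 (v1: Obs. 17)] -/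
theorem vars_EQ_subset : ∀ (ℓ : ℕ) (u v : Fin ℓ → MvPolynomial τ F),
    ∀ y ∈ (BitGadget.EQ ℓ u v).vars, ∃ i, y ∈ (u i).vars ∨ y ∈ (v i).vars
  | 0, u, v => by simp [BitGadget.EQ, vars_one]
  | ℓ + 1, u, v => by
    classical
    intro y hy
    rw [BitGadget.EQ] at hy
    rcases Finset.mem_union.1 (vars_mul _ _ hy) with h | h
    · exact ⟨0, vars_eqBit_subset _ _ y h⟩
    · obtain ⟨i, hi⟩ := vars_EQ_subset ℓ _ _ y h
      exact ⟨i.succ, hi⟩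

omit [DecidableEq τ] in
/-- **The variables of `LT`** are among those of its inputs. [cite: ChatterjeeTengse2023, Obs. 2.9 (v1: Obs. 17)] -/
theorem vars_LT_subset : ∀ (ℓ : ℕ) (u v : Fin ℓ → MvPolynomial τ F),
    ∀ y ∈ (BitGadget.LT ℓ u v).vars, ∃ i, y ∈ (u i).vars ∨ y ∈ (v i).vars
  | 0, u, v => by simp [BitGadget.LT]
  | ℓ + 1, u, v => by
    classical
    intro y hy
    rw [BitGadget.LT] at hy
    rcases Finset.mem_union.1 (vars_add_subset _ _ hy) with h | h
    · rcases Finset.mem_union.1 (vars_mul _ _ h) with h | h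
      · rcases Finset.mem_union.1 (vars_mul _ _ h) with h | h
        · rcases Finset.mem_union.1 (vars_sub_subset _ h) with h | h
          · simp [vars_one] at h
          · exact ⟨0, Or.inl h⟩
        · exact ⟨0, Or.inr h⟩
      · obtain ⟨i, hi⟩ := vars_EQ_subset ℓ _ _ y h
        exact ⟨i.succ, hi⟩
    · obtain ⟨i, hi⟩ := vars_LT_subset ℓ _ _ y h
      exact ⟨i.succ, hi⟩

omit [DecidableEq τ] in
/-- **The variables of `GT`** are among those of its inputs. [cite: ChatterjeeTengse2023, Obs. 2.9 (v1: Obs. 17)] -/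
theorem vars_GT_subset (ℓ : ℕ) (u v : Fin ℓ → MvPolynomial τ F) :
    ∀ y ∈ (BitGadget.GT ℓ u v).vars, ∃ i, y ∈ (u i).vars ∨ y ∈ (v i).vars := fun y hy => by
  classical
  obtain ⟨i, hi⟩ := vars_LT_subset ℓ v u y hy
  exact ⟨i, hi.symm⟩

omit [DecidableEq τ] in
/-- The gadget inputs: `varVec a i` has the variable `a i`, `constVec` none. [cite: ChatterjeeTengse2023, Lemma 3.5 (v1: Lemma 42)] -/
private theorem vars_varVec_constVec {L : ℕ} (a : Fin L → τ) (Kb : Fin L → Bool) (i : Fin L) (y : τ)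
    (h : y ∈ (varVec (F := F) a i).vars ∨ y ∈ (constVec (F := F) (τ := τ) Kb i).vars) : y = a i := by
  rcases h with h | h
  · simpa [varVec, vars_X] using h
  · cases hK : Kb i <;> simp [constVec, bitVal, hK, vars_one] at h

omit [DecidableEq τ] in
/-- The gadget inputs `varVec a`, `varVec b`. [cite: ChatterjeeTengse2023, Lemma 3.5 (v1: Lemma 42)] -/
private theorem vars_varVec_varVec {L : ℕ} (a b : Fin L → τ) (i : Fin L) (y : τ)
    (h : y ∈ (varVec (F := F) a i).vars ∨ y ∈ (varVec (F := F) b i).vars) : y = a i ∨ y = b i := by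
  rcases h with h | h
  · left; simpa [varVec, vars_X] using h
  · right; simpa [varVec, vars_X] using h

omit [DecidableEq τ] in
/-- **The variables of `pow(i)_k`** are row-block variables. [cite: ChatterjeeTengse2023, Lemma 3.5, `pow` (v1: Lemma 42; p0015.txt:L86–L96)] -/
theorem vars_kronPow_subset {L : ℕ} (a : Fin L → τ) (α : F) (Δ : ℕ) (k : Fin m) :
    ((kronPow a α Δ k).vars : Set τ) ⊆ Set.range a := by
  classical
  intro y hy
  rw [Finset.mem_coe, kronPow] at hy
  rcases Finset.mem_union.1 (vars_mul _ _ hy) with h | h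
  · rw [vars_C] at h; simp at h
  · obtain ⟨l, -, hl⟩ := Finset.mem_biUnion.1 (vars_prod _ h)
    rcases Finset.mem_union.1 (vars_add_subset _ _ hl) with h | h
    · rcases Finset.mem_union.1 (vars_mul _ _ h) with h | h
      · exact ⟨l, (by simpa [vars_X] using h : y = a l).symm⟩
      · rw [vars_C] at h; simp at h
    · rcases Finset.mem_union.1 (vars_sub_subset _ h) with h | h
      · simp [vars_one] at h
      · exact ⟨l, (by simpa [vars_X] using h : y = a l).symm⟩

omit [DecidableEq τ] in
/-- **The variables of `g(pow(i))`** are row-block variables (R5 of the assembly seat).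
[cite: ChatterjeeTengse2023, Lemma 3.5, `C_G(pow(i))` (v1: Lemma 42; p0015.txt:L97)] -/
theorem vars_gKron_subset (a : Fin (n * δ) → τ) (α : F) (Δ : ℕ) (g : MvPolynomial (Fin m) F) :
    ((gKron a α Δ g).vars : Set τ) ⊆ Set.range a := by
  classical
  intro y hy
  rw [Finset.mem_coe, gKron, show aeval (fun k => kronPow a α Δ k) g =
    bind₁ (fun k => kronPow a α Δ k) g from rfl] at hy
  obtain ⟨k, -, hk⟩ := mem_vars_bind₁ _ _ hy
  exact vars_kronPow_subset a α Δ k hk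

omit [DecidableEq τ] in
/-- The variables of `ROW_t` over a family. [cite: ChatterjeeTengse2023, Lemma 3.5, `ROW` (v1: Lemma 42; p0015.txt:L97)] -/
theorem vars_rowPolyG_subset (x : Fin n → τ) (a : Fin (n * δ) → τ) (Kb : Fin (n * δ) → Bool)
    (g : Fin n → MvPolynomial τ F) {S : Set τ} (hg : ∀ t, ((g t).vars : Set τ) ⊆ S) (t : Fin n) :
    ((rowPolyG x a Kb g t).vars : Set τ) ⊆ Set.range x ∪ Set.range a ∪ S := by
  classical
  intro y hy
  rw [Finset.mem_coe, rowPolyG] at hy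
  rcases Finset.mem_union.1 (vars_add_subset _ _ hy) with h | h
  · rcases Finset.mem_union.1 (vars_mul _ _ h) with h | h
    · obtain ⟨i, hi⟩ := vars_LT_subset _ _ _ y h
      exact Or.inl (Or.inr ⟨i, (vars_varVec_constVec a Kb i y hi).symm⟩)
    · exact Or.inr (hg t h)
  · rcases Finset.mem_union.1 (vars_mul _ _ h) with h | h
    · obtain ⟨i, hi⟩ := vars_EQ_subset _ _ _ y h
      exact Or.inl (Or.inr ⟨i, (vars_varVec_constVec a Kb i y hi).symm⟩)
    · exact Or.inl (Or.inl ⟨t, (by simpa [vars_X] using h : y = x t).symm⟩)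

omit [DecidableEq τ] in
/-- The variables of a column power. [cite: ChatterjeeTengse2023, Lemma 3.5, `M̃_G(i,j)` (v1: Lemma 42; p0015.txt:L99)] -/
theorem vars_colPow_subset (b : Fin (n * δ) → τ) (R : MvPolynomial τ F) (t : Fin n) :
    ((colPow b R t).vars : Set τ) ⊆ Set.range b ∪ R.vars := by
  classical
  intro y hy
  rw [Finset.mem_coe, colPow] at hy
  obtain ⟨β, -, hβ⟩ := Finset.mem_biUnion.1 (vars_prod _ hy)
  rcases Finset.mem_union.1 (vars_add_subset _ _ hβ) with h | h
  · rcases Finset.mem_union.1 (vars_mul _ _ h) with h | h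
    · exact Or.inl ⟨_, (by simpa [vars_X] using h : y = b (finProdFinEquiv (t, β))).symm⟩
    · exact Or.inr (vars_pow _ _ h)
  · rcases Finset.mem_union.1 (vars_sub_subset _ h) with h | h
    · simp [vars_one] at h
    · exact Or.inl ⟨_, (by simpa [vars_X] using h : y = b (finProdFinEquiv (t, β))).symm⟩

omit [DecidableEq τ] in
/-- The variables of the activity polynomial are block variables. [cite: ChatterjeeTengse2023, Lemma 3.5 (v1: Lemma 42)] -/
theorem vars_actPoly_subset (a : Fin (n * δ) → τ) (Kb : Fin (n * δ) → Bool) :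
    ((actPoly (F := F) a Kb).vars : Set τ) ⊆ Set.range a := by
  classical
  intro y hy
  rw [Finset.mem_coe, actPoly] at hy
  rcases Finset.mem_union.1 (vars_sub_subset _ hy) with h | h
  · simp [vars_one] at h
  · obtain ⟨i, hi⟩ := vars_GT_subset _ _ _ y h
    exact ⟨i, (vars_varVec_constVec a Kb i y hi).symm⟩

omit [DecidableEq τ] in
/-- **The variables of the encoder skeleton** (R5 of the assembly seat): annihilator variables,
the two index blocks, and the variables of the row values.
[cite: ChatterjeeTengse2023, Lemma 3.5 (v1: Lemma 42; p0015.txt:L96–L99)] -/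
theorem vars_encoderSkeleton_subset (x : Fin n → τ) (a b : Fin (n * δ) → τ) (Kb : Fin (n * δ) → Bool)
    (g : Fin n → MvPolynomial τ F) {S : Set τ} (hg : ∀ t, ((g t).vars : Set τ) ⊆ S) :
    ((encoderSkeleton x a b Kb g).vars : Set τ) ⊆ Set.range x ∪ Set.range a ∪ Set.range b ∪ S := by
  classical
  intro y hy
  rw [Finset.mem_coe, encoderSkeleton] at hy
  rcases Finset.mem_union.1 (vars_add_subset _ _ hy) with h | h
  · rcases Finset.mem_union.1 (vars_mul _ _ h) with h | h
    · rcases Finset.mem_union.1 (vars_mul _ _ h) with h | h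
      · exact Or.inl (Or.inl (Or.inr (vars_actPoly_subset a Kb h)))
      · exact Or.inl (Or.inr (vars_actPoly_subset b Kb h))
    · obtain ⟨t, -, ht⟩ := Finset.mem_biUnion.1 (vars_prod _ h)
      rcases vars_colPow_subset b _ t ht with h | h
      · exact Or.inl (Or.inr h)
      · rcases vars_rowPolyG_subset x a Kb g hg t h with (h | h) | h
        · exact Or.inl (Or.inl (Or.inl h))
        · exact Or.inl (Or.inl (Or.inr h))
        · exact Or.inr h
  · rcases Finset.mem_union.1 (vars_mul _ _ h) with h | h
    · rcases Finset.mem_union.1 (vars_sub_subset _ h) with h | h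
      · simp [vars_one] at h
      · exact Or.inl (Or.inr (vars_actPoly_subset b Kb h))
    · obtain ⟨i, hi⟩ := vars_EQ_subset _ _ _ y h
      rcases vars_varVec_varVec a b i y hi with h | h
      · exact Or.inl (Or.inl (Or.inr ⟨i, h.symm⟩))
      · exact Or.inl (Or.inr ⟨i, h.symm⟩)

omit [DecidableEq τ] in
/-- **The variables of the pre-specialised encoder** `encoderSkeleton x a b Kb (gKron a α Δ ∘ G)`:
only `x`, `a`, `b` (what the determinant engine needs: its workspace may be chosen disjoint).
[cite: ChatterjeeTengse2023, Lemma 3.5 with Prop. 2.28 (v1: Lemma 42, Prop. 36)] -/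
theorem vars_encoderSkeleton_gKron_subset (x : Fin n → τ) (a b : Fin (n * δ) → τ)
    (Kb : Fin (n * δ) → Bool) (α : F) (Δ : ℕ) (G : Fin n → MvPolynomial (Fin m) F) :
    ((encoderSkeleton x a b Kb (fun t => gKron a α Δ (G t))).vars : Set τ) ⊆
      Set.range x ∪ Set.range a ∪ Set.range b := by
  classical
  intro y hy
  rcases vars_encoderSkeleton_subset x a b Kb _ (fun t => vars_gKron_subset a α Δ (G t)) hy with h | h
  · exact h
  · exact Or.inl (Or.inr h)

end Vars

end CT23Encoder

end Literature.Barriers.ValiantsHypothesis
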